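import Summits.MatrixMultiplication.OmegaCensus.SmallFormats.InvertiblePointFootprintExclusion
import HarnessLib

/-!
# ω-census family (a): `⟨2,2,7⟩ @ 23` over `𝔽₃` — a `decide`-checkable certificate format for RADO FAILURE

Cell `pub-omega` (unit `pub-omega-tensor-g32`), topic `Summits/MatrixMultiplication/OmegaCensus` (sub-folder `SmallFormats`).
Framing (verbatim): lottery ticket; floor = certified bounds/negative ranges. HONEST FRAMING: bookkeeping — the checker behind
input (R) of `twentyfour_le_tensorRank_227_gf3_of_catalog` (`MatMul227GF3FootprintReduction`). A certificate that the marginal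
`m` FAILS RADO at `X₀` against the catalog tuple `b` (9 rows of `𝔽₃^{2×7}`, base-3 coded) consists of: a set `T` of off-terms
(bit mask), `t` functionals `ν_ℓ` on `𝔽₃^{2×7}` (coded coefficient matrices `H_ℓ`) with pivot positions, and for every `ℓ` and
`i ∈ T` fifteen coefficients expressing `H_ℓ` as `Σ_{a,e} c_{ae} X_{i,a}ᵀ G_e` where the `X_{i,a}` lie in `ker f_i` and the `G_e`
annihilate the rows of `b`. Then every `ν_ℓ` kills every admissible space `B_{ker f_i}(span b)` (`i ∈ T`), the `ν_ℓ` are jointly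
surjective onto `𝔽₃^t` (pivots), so `dim Σ_{i∈T} B_i ≤ 14 − t`, and `14 < t + |T|` is Rado failure. `CertOK` states these finitely
many `𝔽₃`-identities (decidable; meant to be discharged by `decide` on explicit data); `radoFails_of_certOK` is its soundness.
No certificate data in this file; nothing on `ω`.
-/

namespace Summit.MatrixMultiplication.OmegaCensus.SmallFormats

open Module Matrix Literature.Computability.AlgebraicComplexity RankOnePlaneCapGeneral

/-! ## Base-3 coding of vectors and matrices -/

/-- Digit `p` of `n` in base 3, read in `𝔽₃`. -/
def trit (n p : ℕ) : ZMod 3 := ((n / 3 ^ p % 3 : ℕ) : ZMod 3)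

/-- The `2 × 7` matrix with code `n` (entry `(r,c)` = digit `7r + c`). -/
def decM (n : ℕ) : Matrix (Fin 2) (Fin 7) (ZMod 3) := Matrix.of fun r c => trit n (7 * r + c)

/-- The `2 × 2` matrix with code `n` (entry `(r,c)` = digit `2r + c`). -/
def decX (n : ℕ) : Matrix (Fin 2) (Fin 2) (ZMod 3) := Matrix.of fun r c => trit n (2 * r + c)

/-- Entries of `decM`. -/
@[simp] theorem decM_apply (n : ℕ) (r : Fin 2) (c : Fin 7) : decM n r c = trit n (7 * r + c) := rfl

/-- Entries of `decX`. -/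
@[simp] theorem decX_apply (n : ℕ) (r c : Fin 2) : decX n r c = trit n (2 * r + c) := rfl

/-- A catalog tuple from its nine row codes. -/
def decB (rows : List ℕ) : Fin 9 → Matrix (Fin 2) (Fin 7) (ZMod 3) := fun s => decM (rows.getD s 0)

/-- The linear functional on `𝔽₃^{2×7}` with coefficient matrix `H`: `W ↦ Σ_{r,c} H_{rc} W_{rc}`. -/
def formN (H : Matrix (Fin 2) (Fin 7) (ZMod 3)) : Module.Dual (ZMod 3) (Matrix (Fin 2) (Fin 7) (ZMod 3)) where
  toFun W := ∑ r, ∑ c, H r c * W r c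
  map_add' W W' := by
    simp only [Matrix.add_apply, mul_add, Finset.sum_add_distrib]
  map_smul' a W := by
    simp only [Matrix.smul_apply, smul_eq_mul, Finset.mul_sum, RingHom.id_apply]
    exact Finset.sum_congr rfl fun r _ => Finset.sum_congr rfl fun c _ => by ring

/-- `formN H W = Σ_{r,c} H_{rc} W_{rc}`. -/
@[simp] theorem formN_apply (H W : Matrix (Fin 2) (Fin 7) (ZMod 3)) : formN H W = ∑ r, ∑ c, H r c * W r c := rfl

/-- `formN` is additive in the coefficient matrix. -/
theorem formN_add (H H' : Matrix (Fin 2) (Fin 7) (ZMod 3)) : formN (H + H') = formN H + formN H' := by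
  ext W
  simp only [formN_apply, LinearMap.add_apply, Matrix.add_apply, add_mul, Finset.sum_add_distrib]

/-- `formN` is homogeneous in the coefficient matrix. -/
theorem formN_smul (a : ZMod 3) (H : Matrix (Fin 2) (Fin 7) (ZMod 3)) : formN (a • H) = a • formN H := by
  ext W
  simp only [formN_apply, LinearMap.smul_apply, Matrix.smul_apply, smul_eq_mul, Finset.mul_sum, mul_assoc]

/-- `formN` of a finite sum of coefficient matrices. -/
theorem formN_sum {ι : Type*} (s : Finset ι) (H : ι → Matrix (Fin 2) (Fin 7) (ZMod 3)) :
    formN (∑ x ∈ s, H x) = ∑ x ∈ s, formN (H x) := by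
  classical
  induction s using Finset.induction_on with
  | empty =>
      ext W
      simp
  | insert x s hx ih => rw [Finset.sum_insert hx, Finset.sum_insert hx, formN_add, ih]

/-- **Transport of a functional through a left multiplication.** `formN (Xᵀ G) W = formN G (X W)`. -/
theorem formN_transpose_mul (X : Matrix (Fin 2) (Fin 2) (ZMod 3)) (G W : Matrix (Fin 2) (Fin 7) (ZMod 3)) :
    formN (Xᵀ * G) W = formN G (X * W) := by
  simp only [formN_apply, Matrix.mul_apply, Matrix.transpose_apply, Fin.sum_univ_two, Fin.sum_univ_seven]
  ring

/-- `formN H` evaluated at the elementary matrix `E_{rc}` is the entry `H_{rc}`. -/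
theorem formN_single (H : Matrix (Fin 2) (Fin 7) (ZMod 3)) (r : Fin 2) (c : Fin 7) :
    formN H (Matrix.single r c 1) = H r c := by
  simp only [formN_apply, Fin.sum_univ_two, Fin.sum_univ_seven, Matrix.single_apply]
  fin_cases r <;> fin_cases c <;> simp

/-! ## The certificate format -/

/-- A Rado-failure certificate (all data base-3 / bit coded): `Tmask` = the set `T` of off-terms (bit `i`), `H` = the codes of the
`t` functionals, `piv` = their pivot positions (`7r + c`), `C` = for each `ℓ < t` a list indexed by the term `i < 23` of the code of
the 15 coefficients `c_{ae}` (`a < 3`, `e < 5`, digit `5a + e`). -/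
structure Cert where
  /-- bit mask of the off-terms used -/
  Tmask : ℕ
  /-- codes of the functionals `ν_ℓ` -/
  H : List ℕ
  /-- pivot positions -/
  piv : List ℕ
  /-- coefficient codes, per functional and per term -/
  C : List (List ℕ)

/-- `formOf U X` written as the explicit four-term sum (for `decide`). -/
def fval (U X : Matrix (Fin 2) (Fin 2) (ZMod 3)) : ZMod 3 :=
  X 0 0 * U 0 0 + X 0 1 * U 0 1 + X 1 0 * U 1 0 + X 1 1 * U 1 1

/-- `fval = formOf`. -/
theorem fval_eq (U X : Matrix (Fin 2) (Fin 2) (ZMod 3)) : fval U X = formOf U X := by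
  rw [formOf_apply, fval]
  simp only [Fin.sum_univ_two]
  ring

/-- The combination `Σ_{a<3,e<5} c_{ae} (X_aᵀ G_e)_{r'c}` from codes: `Ki` = the three kernel-matrix codes of the term, `ann` = the five
annihilator codes, `cc` = the coefficient code. -/
def comb (Ki ann : List ℕ) (cc : ℕ) (r' : Fin 2) (c : Fin 7) : ZMod 3 :=
  ∑ a : Fin 3, ∑ e : Fin 5, trit cc (5 * a + e) *
    ∑ r : Fin 2, trit (Ki.getD a 0) (2 * r + r') * trit (ann.getD e 0) (7 * r + c)

/-- The set `T` of a certificate as a `Finset (Fin 23)`. -/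
def tset (c : Cert) : Finset (Fin 23) := Finset.univ.filter fun i : Fin 23 => c.Tmask.testBit i = true

/-- **The checkable conditions.** For the marginal `m`, the point `X₀`, kernel-matrix codes `K` (three per term), the catalog tuple
with row codes `rows` and annihilator codes `ann` (five), and a certificate `c`:
(1) the five `G_e` annihilate the nine rows; (2) every `i ∈ T` is an off-term, its three `X_{i,a}` lie in `ker f_i`, and every
`H_ℓ` equals `Σ_{a,e} c_{ae} X_{i,a}ᵀ G_e` entrywise; (3) pivots: `(H_{ℓ'})_{p_ℓ} = δ_{ℓℓ'}`, `p_ℓ < 14`; (4) `14 < t + |T|`. -/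
def CertOK (m : Fin 23 → Matrix (Fin 2) (Fin 2) (ZMod 3)) (X₀ : Matrix (Fin 2) (Fin 2) (ZMod 3)) (K : List (List ℕ))
    (rows ann : List ℕ) (c : Cert) : Prop :=
  (∀ e < 5, ∀ s < 9, (∑ p : Fin 14, trit (ann.getD e 0) p * trit (rows.getD s 0) p) = 0) ∧
  (∀ i : Fin 23, c.Tmask.testBit i = true →
      fval (m i) X₀ ≠ 0 ∧ (∀ a < 3, fval (m i) (decX ((K.getD i []).getD a 0)) = 0) ∧
      ∀ ℓ < c.H.length, ∀ r' : Fin 2, ∀ cc : Fin 7,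
        trit (c.H.getD ℓ 0) (7 * r' + cc) = comb (K.getD i []) ann ((c.C.getD ℓ []).getD i 0) r' cc) ∧
  (∀ ℓ < c.H.length, c.piv.getD ℓ 0 < 14 ∧
      ∀ ℓ' < c.H.length, trit (c.H.getD ℓ' 0) (c.piv.getD ℓ 0) = if ℓ = ℓ' then 1 else 0) ∧
  14 < c.H.length + (tset c).card

/-- `CertOK` is decidable (a finite conjunction of `𝔽₃` identities); certificates are checked by `decide`. -/
instance instDecidableCertOK (m : Fin 23 → Matrix (Fin 2) (Fin 2) (ZMod 3)) (X₀ : Matrix (Fin 2) (Fin 2) (ZMod 3))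
    (K : List (List ℕ)) (rows ann : List ℕ) (c : Cert) : Decidable (CertOK m X₀ K rows ann c) := by
  unfold CertOK; infer_instance

/-! ## Soundness -/

/-- Reindexing `p = 7r + c`. -/
theorem sum_fin14 (f : ℕ → ZMod 3) : (∑ p : Fin 14, f p) = ∑ r : Fin 2, ∑ c : Fin 7, f (7 * r + c) := by
  simp only [Fin.sum_univ_succ, Fin.sum_univ_zero, Fin.val_zero, Fin.val_succ, add_zero]
  norm_num
  ring

/-- The rows of a coded catalog tuple are killed by a coded annihilator (condition (1)). -/
theorem formN_decB_eq_zero {rows ann : List ℕ} {e : ℕ} (he : e < 5)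
    (h1 : ∀ e < 5, ∀ s < 9, (∑ p : Fin 14, trit (ann.getD e 0) p * trit (rows.getD s 0) p) = 0) (s : Fin 9) :
    formN (decM (ann.getD e 0)) (decB rows s) = 0 := by
  have h := h1 e he s s.2
  rw [sum_fin14 (fun p => trit (ann.getD e 0) p * trit (rows.getD s 0) p)] at h
  rw [formN_apply, ← h]
  rfl

/-- The functional of a certificate kills the admissible space of each of its terms. -/
theorem formN_H_eq_zero_of_mem_fpSpace {m : Fin 23 → Matrix (Fin 2) (Fin 2) (ZMod 3)} {K : List (List ℕ)}
    {rows ann : List ℕ} {h cc : ℕ} {i : Fin 23}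
    (h1 : ∀ e < 5, ∀ s < 9, (∑ p : Fin 14, trit (ann.getD e 0) p * trit (rows.getD s 0) p) = 0)
    (hK : ∀ a < 3, fval (m i) (decX ((K.getD i []).getD a 0)) = 0)
    (hH : ∀ r' : Fin 2, ∀ c : Fin 7, trit h (7 * r' + c) = comb (K.getD i []) ann cc r' c)
    {W : Matrix (Fin 2) (Fin 7) (ZMod 3)}
    (hW : W ∈ fpSpace (LinearMap.ker (formOf (m i))) (Submodule.span (ZMod 3) (Set.range (decB rows)))) :
    formN (decM h) W = 0 := by
  -- `decM h = Σ_{a,e} c_{ae} • (X_aᵀ * G_e)`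
  set X : Fin 3 → Matrix (Fin 2) (Fin 2) (ZMod 3) := fun a => decX ((K.getD i []).getD a 0) with hXdef
  set G : Fin 5 → Matrix (Fin 2) (Fin 7) (ZMod 3) := fun e => decM (ann.getD e 0) with hGdef
  have hdec : decM h = ∑ a : Fin 3, ∑ e : Fin 5, trit cc (5 * a + e) • ((X a)ᵀ * G e) := by
    ext r' c
    rw [decM_apply, hH r' c, comb]
    simp only [Matrix.sum_apply, Matrix.smul_apply, smul_eq_mul, Matrix.mul_apply, Matrix.transpose_apply,
      hXdef, hGdef, decX_apply, decM_apply]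
  -- each `X_a W ∈ span b`, killed by each `G_e`
  have hXker : ∀ a : Fin 3, X a ∈ LinearMap.ker (formOf (m i)) := fun a => by
    rw [LinearMap.mem_ker, ← fval_eq]; exact hK a a.2
  have hGspan : ∀ e : Fin 5, ∀ V ∈ Submodule.span (ZMod 3) (Set.range (decB rows)), formN (G e) V = 0 := by
    intro e V hV
    induction hV using Submodule.span_induction with
    | mem x hx =>
        obtain ⟨s, rfl⟩ := hx
        exact formN_decB_eq_zero e.2 h1 s
    | zero => exact map_zero _
    | add x y _ _ hx hy => rw [map_add, hx, hy, add_zero]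
    | smul a x _ hx => rw [map_smul, hx, smul_zero]
  rw [hdec, formN_sum, LinearMap.sum_apply]
  refine Finset.sum_eq_zero fun a _ => ?_
  rw [formN_sum, LinearMap.sum_apply]
  refine Finset.sum_eq_zero fun e _ => ?_
  rw [formN_smul, LinearMap.smul_apply, formN_transpose_mul, hGspan e _ (hW (X a) (hXker a)), smul_zero]

/-- **Soundness of the certificate format.** `CertOK ⇒ RadoFails` for the decoded catalog tuple. -/
theorem radoFails_of_certOK {m : Fin 23 → Matrix (Fin 2) (Fin 2) (ZMod 3)} {X₀ : Matrix (Fin 2) (Fin 2) (ZMod 3)}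
    {K : List (List ℕ)} {rows ann : List ℕ} {c : Cert} (hc : CertOK m X₀ K rows ann c) :
    RadoFails m X₀ (decB rows) := by
  obtain ⟨h1, h2, h3, h4⟩ := hc
  refine ⟨tset c, fun j hj => ?_, ?_⟩
  · rw [← fval_eq]; exact (h2 j (Finset.mem_filter.mp hj).2).1
  -- the functionals `ν_ℓ = formN (decM H_ℓ)`, jointly `Φ`
  let Φ : Matrix (Fin 2) (Fin 7) (ZMod 3) →ₗ[ZMod 3] (Fin c.H.length → ZMod 3) :=
    LinearMap.pi fun ℓ : Fin c.H.length => formN (decM (c.H.getD ℓ 0))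
  have hΦ : ∀ W ℓ, Φ W ℓ = formN (decM (c.H.getD ℓ 0)) W := fun W ℓ => rfl
  -- `⨆ B_i ≤ ker Φ`
  have hle : (⨆ j ∈ tset c, fpSpace (LinearMap.ker (formOf (m j))) (Submodule.span (ZMod 3) (Set.range (decB rows))) :
      Submodule (ZMod 3) (Matrix (Fin 2) (Fin 7) (ZMod 3))) ≤ LinearMap.ker Φ := by
    refine iSup₂_le fun j hj => ?_
    intro W hW
    rw [LinearMap.mem_ker]
    funext ℓ
    rw [hΦ, Pi.zero_apply]
    have hj' := h2 j (Finset.mem_filter.mp hj).2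
    exact formN_H_eq_zero_of_mem_fpSpace h1 hj'.2.1 (hj'.2.2 ℓ ℓ.2) hW
  -- `Φ` is surjective: pivots
  have hpiv : ∀ ℓ : Fin c.H.length, c.piv.getD ℓ 0 < 14 := fun ℓ => (h3 ℓ ℓ.2).1
  let E : Fin c.H.length → Matrix (Fin 2) (Fin 7) (ZMod 3) := fun ℓ =>
    Matrix.single (⟨c.piv.getD ℓ 0 / 7, by have := hpiv ℓ; omega⟩ : Fin 2)
      (⟨c.piv.getD ℓ 0 % 7, Nat.mod_lt _ (by norm_num)⟩ : Fin 7) (1 : ZMod 3)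
  have hE : ∀ ℓ ℓ' : Fin c.H.length, Φ (E ℓ) ℓ' = if ℓ = ℓ' then 1 else 0 := by
    intro ℓ ℓ'
    rw [hΦ]
    show formN (decM (c.H.getD ℓ' 0)) (Matrix.single _ _ 1) = _
    rw [formN_single, decM_apply]
    have hp : 7 * (c.piv.getD ℓ 0 / 7) + c.piv.getD ℓ 0 % 7 = c.piv.getD ℓ 0 := by omega
    rw [hp, (h3 ℓ ℓ.2).2 ℓ' ℓ'.2]
    by_cases hℓ : ℓ = ℓ'
    · subst hℓ; simp
    · rw [if_neg (fun h => hℓ (Fin.ext h)), if_neg hℓ]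
  have hsurj : LinearMap.range Φ = ⊤ := by
    rw [LinearMap.range_eq_top]
    intro v
    refine ⟨∑ ℓ : Fin c.H.length, v ℓ • E ℓ, ?_⟩
    funext ℓ'
    rw [map_sum, Finset.sum_apply]
    simp_rw [map_smul, Pi.smul_apply, hE, smul_eq_mul, mul_ite, mul_one, mul_zero]
    rw [Finset.sum_ite_eq' Finset.univ ℓ' (fun ℓ => v ℓ)]
    simp
  -- dimension count
  have hrank := LinearMap.finrank_range_add_finrank_ker Φ
  rw [finrank_matrix_fin, hsurj, finrank_top, Module.finrank_pi, Fintype.card_fin] at hrank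
  have hN := Submodule.finrank_mono hle
  omega

end Summit.MatrixMultiplication.OmegaCensus.SmallFormats
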